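import Summits.ABC.IUTFork.LDHLopsidedWitnessOrders
import HarnessLib

/-!
# The fork at [IUTchIII] Corollary 3.12, L-DH level: a LOPSIDED point family on the `λ`-line over `ℚ(i)` —
# III. admissibility data of `P_k = (F, λ_k)`: `U_P`, `d_mod = 2`, a core, (P5), the compact domain `K_V = std ∅`,
# and the archimedean sizes `|a| = 5^k`, `|b| ≤ 3·5^k`, `|c| ≤ 2·5^k`

Proof-only file (D-0012; 0 definitions, no `Prop` fact) of the abc-iut cell (seat abc-iut-w5-d126, gen 5; row
«HABOVE-LOPSIDED-WITNESS», crux `ThetaPartII` = stmt-ABC-19678, (U) line, VERDICT RISK ¶7). TAKES NO SIDE on [IUTchIII]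
Cor. 3.12 or [IUTchIV] Thm. 1.10; classical arithmetic of the `λ`-line over `ℚ(i)`. Sequel of `LDHLopsidedWitnessPoint` /
`…Orders` (`λ_k = a/b`, `a = π^{2k}`, `b = 2a + 1`, `c = a + 1`, `π = 2 + i`). S. Mochizuki, *IUT IV* [Mochizuki2012], Cor. 2.2
(ii) proof pp. 43–46 (core, (P5)); *Arithmetic elliptic curves in general position* [MochizukiGenEll2010] Def. 1.5 (i) p. 8
(`U_P`, minimal presentation), Ex. 1.3 (ii) p. 5 (compactly bounded subsets); [IrelandRosen1982] Ch. 9 §7 p. 120;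
Dupuy–Hilado [DupuyHilado2025] §2.4.2, §3.6.

* `exists_places` — two DISTINCT places `V ∋ π`, `W ∋ π̄` of `F` over `5` (`W = V̄` under complex conjugation);
* **`point_data`** — for `k ≥ 1`: `P_k ∈ UP` (`λ_k ≠ 0, 1`, `ℚ(λ_k) = F`), `ℚ(j(λ_k)) = F` and `d_mod(P_k) = 2`, `P_k` admits
  a core, (P5) at every prime `l ≠ 5`, `ord_V j(λ_k) ≤ −4k`, `0 ≤ ord_W j(λ_k)`, `2 ∉ V`, `l ∉ V` (`l ≠ 5`), `n_V = 1`,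
  `Pr(V) = Pr(W) = 1/2`, `ln N(V) = ln 5` — everything from the split pole: `j(λ_k)` is irrational (pole at `V`, none at
  the conjugate `W`, abc-iut-s2-p3's `SplitDepth.not_mem_bot_of_ord_neg_of_ord_nonneg`), hence so is `λ_k`, and `ℚ(i)` is
  quadratic;
* `norm_embedding_pi` (`|φ(π)| = √5`), `norm_embedding_a` (`= 5^k`), `two_le_norm_embedding_b`, `norm_embedding_b_le`
  (`≤ 3·5^k`), `norm_embedding_c_le` (`≤ 2·5^k`), `dist_embedding_lam_le` (`|φ(λ_k) − 1/2| ≤ 1/4`), **`mem_std_empty`**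
  (`P_k ∈ K_V` for `K_V = CBData.std ∅`: the input of `Cor22.condP6_of_seven_le`).
HONEST SCOPE: classical; nothing asserted about print; nothing about Cor. 3.12. [cite: MochizukiGenEll2010, Def 1.5 (i) p.8]
[cite: MochizukiGenEll2010, Ex 1.3 (ii) p.5] [cite: IrelandRosen1982, Ch. 9 §7 p. 120] [cite: DupuyHilado2025, §2.4.2, §3.6]
[claim: Mochizuki2012, status: disputed] for every IUT locator quoted.
-/

noncomputable section

namespace Summit.ABC.IUTFork

namespace LopsidedWitness

open NumberField IsDedekindDomain Metric Finset
open Literature.IUT.LogVolume Literature.IUT.LogVolume.Cor22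
open Literature.NumberTheory.DiophantineGeometry Literature.NumberTheory.DiophantineGeometry.GenEll
open Literature.NumberTheory.NumberFields
open SplitBadWitness

variable {F : Type} [Field F] [NumberField F] {ζ : 𝓞 F}

/-! ## Two distinct places `V ∋ π`, `W ∋ π̄` over `5` -/

/-- **Two distinct places of `F` over `5`: `V ∋ π` and `W = V̄ ∋ π̄`.** [cite: IrelandRosen1982, Ch. 9 §7 p. 120]
[cite: DupuyHilado2025, §3.6] -/
theorem exists_places [IsCyclotomicExtension {4} ℚ F] (hζ : IsPrimitiveRoot ζ 4) :
    haveI : Fact (Nat.Prime 5) := ⟨by norm_num⟩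
    ∃ V W : placesOver F 5, W ≠ V ∧ (2 + ζ : 𝓞 F) ∈ V.1.asIdeal ∧ (2 - ζ : 𝓞 F) ∈ W.1.asIdeal := by
  haveI : Fact (Nat.Prime 5) := ⟨by norm_num⟩
  obtain ⟨V, hV⟩ := exists_place_pi hζ
  obtain ⟨τ, hτ, -⟩ := exists_conj hζ
  have hW := piBar_mem_comap τ hτ hV
  refine ⟨⟨V, mem_placesOver_five (five_mem hζ hV)⟩,
    ⟨HeightOneSpectrum.comap (τ : 𝓞 F →+* 𝓞 F) τ.surjective V, mem_placesOver_five (five_mem' hζ hW)⟩,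
    fun h => ?_, hV, hW⟩
  have h' : HeightOneSpectrum.comap (τ : 𝓞 F →+* 𝓞 F) τ.surjective V = V := congrArg Subtype.val h
  rw [h'] at hW
  exact piBar_notMem hζ hV hW

/-! ## The admissibility data of `P_k` -/

/-- `j` commutes with the inclusion of `ℚ`: `j(q) ∈ ℚ` for rational `q`. [cite: MochizukiGenEll2010, Def 1.5 (i) p.8] -/
theorem jInv_ratCast (q : ℚ) : jInv ((q : F)) = ((jInv q : ℚ) : F) := by
  unfold jInv; push_cast; ring

/-- **The point data of `P_k = (F, λ_k)`, `k ≥ 1`.** With the places `V ∋ π`, `W ∋ π̄` over `5`: `P_k ∈ UP`; `ℚ(j(λ_k)) = F`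
and `d_mod = 2`; `P_k` admits a core; (P5) at every prime `l ≠ 5`; `ord_V j(λ_k) ≤ −4k`, `0 ≤ ord_W j(λ_k)`; `2 ∉ V`,
`l ∉ V` for primes `l ≠ 5`; `n_V = 1`, `Pr(V) = Pr(W) = 1/2`, `ln N(V) = ln 5`. The split pole makes `j(λ_k)` — hence `λ_k` —
irrational, and `[F:ℚ] = 2`. [cite: MochizukiGenEll2010, Def 1.5 (i) p.8] [cite: Mochizuki2012, IUTchIV Cor. 2.2 (ii) proof p. 43–46]
[claim: Mochizuki2012, status: disputed] [cite: DupuyHilado2025, §2.4.2, §3.6] -/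
theorem point_data [IsCyclotomicExtension {4} ℚ F] (hζ : IsPrimitiveRoot ζ 4) {k : ℕ} (hk : 1 ≤ k) :
    haveI : Fact (Nat.Prime 5) := ⟨by norm_num⟩
    ∃ V W : placesOver F 5, W ≠ V ∧ (2 + ζ : 𝓞 F) ∈ V.1.asIdeal ∧ (2 - ζ : 𝓞 F) ∈ W.1.asIdeal ∧
      NFPoint.mk F ((2 + (ζ : F)) ^ (2 * k) / (2 * (2 + (ζ : F)) ^ (2 * k) + 1)) ∈ UP ∧
      IntermediateField.adjoin ℚ ({jInv ((2 + (ζ : F)) ^ (2 * k) / (2 * (2 + (ζ : F)) ^ (2 * k) + 1))} : Set F) = ⊤ ∧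
      dmod (NFPoint.mk F ((2 + (ζ : F)) ^ (2 * k) / (2 * (2 + (ζ : F)) ^ (2 * k) + 1))) = 2 ∧
      AdmitsCore (NFPoint.mk F ((2 + (ζ : F)) ^ (2 * k) / (2 * (2 + (ζ : F)) ^ (2 * k) + 1))) ∧
      (∀ l : ℕ, l.Prime → l ≠ 5 → CondP5 (NFPoint.mk F ((2 + (ζ : F)) ^ (2 * k) / (2 * (2 + (ζ : F)) ^ (2 * k) + 1))) l) ∧
      ord F V.1 (jInv ((2 + (ζ : F)) ^ (2 * k) / (2 * (2 + (ζ : F)) ^ (2 * k) + 1))) ≤ -(2 * (2 * k : ℕ) : ℤ) ∧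
      0 ≤ ord F W.1 (jInv ((2 + (ζ : F)) ^ (2 * k) / (2 * (2 + (ζ : F)) ^ (2 * k) + 1))) ∧
      ((2 : ℕ) : 𝓞 F) ∉ V.1.asIdeal ∧ (∀ l : ℕ, l.Prime → l ≠ 5 → ((l : ℕ) : 𝓞 F) ∉ V.1.asIdeal) ∧
      localDegree F V.1 = 1 ∧ weight F V.1 = 1 / 2 ∧ weight F W.1 = 1 / 2 ∧ logNorm F V.1 = Real.log 5 := by
  haveI : Fact (Nat.Prime 5) := ⟨by norm_num⟩
  obtain ⟨V, W, hVW, hV, hW⟩ := exists_places hζ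
  set x : F := (2 + (ζ : F)) ^ (2 * k) / (2 * (2 + (ζ : F)) ^ (2 * k) + 1) with hx
  have hF : Module.finrank ℚ F = 2 := finrank_eq_two F
  have hjv : ord F V.1 (jInv x) ≤ -(2 * (2 * k : ℕ) : ℤ) := ord_jInv_V_le hζ hV hk
  have hjv' : ord F V.1 (jInv x) < 0 := by
    have hk' : (1 : ℤ) ≤ k := by exact_mod_cast hk
    push_cast at hjv; linarith
  have hjw : 0 ≤ ord F W.1 (jInv x) := ord_jInv_W_nonneg hζ hW hk
  -- `j(λ_k)` and `λ_k` are irrational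
  have hjb : jInv x ∉ (⊥ : IntermediateField ℚ F) := SplitDepth.not_mem_bot_of_ord_neg_of_ord_nonneg V W hjv' hjw
  have hxb : x ∉ (⊥ : IntermediateField ℚ F) := by
    intro hxb
    apply hjb
    obtain ⟨q, hq⟩ := IntermediateField.mem_bot.mp hxb
    rw [IntermediateField.mem_bot]
    refine ⟨jInv q, ?_⟩
    rw [← hq, eq_ratCast, eq_ratCast, jInv_ratCast]
  have h2 : ((2 : ℕ) : 𝓞 F) ∉ V.1.asIdeal := by rw [Nat.cast_ofNat]; exact two_notMem (five_mem hζ hV)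
  have hl : ∀ l : ℕ, l.Prime → l ≠ 5 → ((l : ℕ) : 𝓞 F) ∉ V.1.asIdeal :=
    fun l hl hl5 => natCast_notMem (five_mem hζ hV) hl hl5
  obtain ⟨hn1, -⟩ := SplitDepth.localDegree_eq_one hF V W hVW
  obtain ⟨hwt1, hlog⟩ := SplitDepth.weight_eq_half_and_logNorm_eq hF V W hVW
  obtain ⟨hwt2, -⟩ := SplitDepth.weight_eq_half_and_logNorm_eq hF W V (Ne.symm hVW)
  have htop : IntermediateField.adjoin ℚ ({jInv x} : Set F) = ⊤ := SplitDepth.adjoin_simple_eq_top_of_not_mem_bot hF hjb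
  refine ⟨V, W, hVW, hV, hW, ⟨⟨lam_ne_zero hζ hk, lam_ne_one hζ hk⟩, ?_⟩, htop, ?_, ?_, ?_, hjv, hjw, h2, hl,
    hn1, hwt1, hwt2, by rw [hlog]; norm_num⟩
  · -- minimality: `ℚ(λ_k) = F`
    exact SplitDepth.adjoin_simple_eq_top_of_not_mem_bot hF hxb
  · -- `d_mod = [ℚ(j(λ_k)):ℚ] = 2`
    show Module.finrank ℚ (IntermediateField.adjoin ℚ ({jInv x} : Set F)) = 2
    rw [htop, IntermediateField.finrank_top', hF]
  · -- admits a core: the exceptional `j` are rational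
    intro q _ hq
    exact hjb (hq ▸ (IntermediateField.mem_bot.mpr ⟨q, (eq_ratCast (algebraMap ℚ F) q)⟩))
  · -- (P5) at every prime `l ≠ 5`
    intro l hlP hl5
    exact ⟨V.1, hjv', h2, hl l hlP hl5⟩

/-! ## Archimedean sizes of `π`, `a`, `b`, `c`, and the compact domain `K_V = std ∅` -/

/-- `|φ(π)| = √5` for every embedding `φ : F → ℂ` (`φ(i) = ±I`). [cite: IrelandRosen1982, Ch. 9 §7 p. 120] -/
theorem norm_embedding_pi (hζ : IsPrimitiveRoot ζ 4) (φ : F →+* ℂ) : ‖φ (2 + (ζ : F))‖ = Real.sqrt 5 := by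
  have hsq : Complex.normSq (φ (2 + (ζ : F))) = 5 := by
    rw [map_add, map_ofNat]
    rcases embedding_coe hζ φ with h | h
    · rw [h, show (2 : ℂ) + Complex.I = ((2 : ℝ) : ℂ) + ((1 : ℝ) : ℂ) * Complex.I by push_cast; ring,
        Complex.normSq_add_mul_I]; norm_num
    · rw [h, show (2 : ℂ) + -Complex.I = ((2 : ℝ) : ℂ) + ((-1 : ℝ) : ℂ) * Complex.I by push_cast; ring,
        Complex.normSq_add_mul_I]; norm_num
  rw [← Real.sqrt_sq (norm_nonneg _), ← Complex.normSq_eq_norm_sq, hsq]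

/-- `|φ(a)| = |φ(π^{2k})| = 5^k`. [cite: IrelandRosen1982, Ch. 9 §7 p. 120] -/
theorem norm_embedding_a (hζ : IsPrimitiveRoot ζ 4) (φ : F →+* ℂ) (k : ℕ) :
    ‖φ ((2 + (ζ : F)) ^ (2 * k))‖ = 5 ^ k := by
  rw [map_pow, norm_pow, norm_embedding_pi hζ φ, pow_mul, Real.sq_sqrt (by norm_num)]

/-- `|φ(b)| ≥ 2·5^k − 1 ≥ 2` (`k ≥ 1`). [cite: IrelandRosen1982, Ch. 9 §7 p. 120] -/
theorem two_le_norm_embedding_b (hζ : IsPrimitiveRoot ζ 4) (φ : F →+* ℂ) {k : ℕ} (hk : 1 ≤ k) :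
    2 ≤ ‖φ (2 * (2 + (ζ : F)) ^ (2 * k) + 1)‖ := by
  have ha := norm_embedding_a hζ φ k
  have h5 : (5 : ℝ) ≤ 5 ^ k := by
    calc (5 : ℝ) = 5 ^ 1 := (pow_one _).symm
      _ ≤ 5 ^ k := pow_le_pow_right₀ (by norm_num) hk
  have h2a : ‖φ (2 * (2 + (ζ : F)) ^ (2 * k))‖ = 2 * 5 ^ k := by
    rw [map_mul, map_ofNat, norm_mul, Complex.norm_ofNat, ha]
  have htri : ‖φ (2 * (2 + (ζ : F)) ^ (2 * k))‖ ≤ ‖φ (2 * (2 + (ζ : F)) ^ (2 * k) + 1)‖ + ‖(1 : ℂ)‖ := by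
    have e : φ (2 * (2 + (ζ : F)) ^ (2 * k)) = φ (2 * (2 + (ζ : F)) ^ (2 * k) + 1) - 1 := by
      rw [map_add, map_one]; ring
    rw [e]; exact norm_sub_le _ _
  rw [h2a, norm_one] at htri
  linarith

/-- `|φ(b)| ≤ 2·5^k + 1 ≤ 3·5^k`. [cite: IrelandRosen1982, Ch. 9 §7 p. 120] -/
theorem norm_embedding_b_le (hζ : IsPrimitiveRoot ζ 4) (φ : F →+* ℂ) (k : ℕ) :
    ‖φ (2 * (2 + (ζ : F)) ^ (2 * k) + 1)‖ ≤ 3 * 5 ^ k := by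
  have ha := norm_embedding_a hζ φ k
  have h1 : (1 : ℝ) ≤ 5 ^ k := one_le_pow₀ (by norm_num)
  calc ‖φ (2 * (2 + (ζ : F)) ^ (2 * k) + 1)‖
      ≤ ‖φ (2 * (2 + (ζ : F)) ^ (2 * k))‖ + ‖φ (1 : F)‖ := by rw [map_add]; exact norm_add_le _ _
    _ = 2 * 5 ^ k + 1 := by rw [map_mul, map_ofNat, norm_mul, Complex.norm_ofNat, ha, map_one, norm_one]
    _ ≤ 3 * 5 ^ k := by linarith

/-- `|φ(c)| ≤ 5^k + 1 ≤ 2·5^k`. [cite: IrelandRosen1982, Ch. 9 §7 p. 120] -/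
theorem norm_embedding_c_le (hζ : IsPrimitiveRoot ζ 4) (φ : F →+* ℂ) (k : ℕ) :
    ‖φ ((2 + (ζ : F)) ^ (2 * k) + 1)‖ ≤ 2 * 5 ^ k := by
  have ha := norm_embedding_a hζ φ k
  have h1 : (1 : ℝ) ≤ 5 ^ k := one_le_pow₀ (by norm_num)
  calc ‖φ ((2 + (ζ : F)) ^ (2 * k) + 1)‖
      ≤ ‖φ ((2 + (ζ : F)) ^ (2 * k))‖ + ‖φ (1 : F)‖ := by rw [map_add]; exact norm_add_le _ _
    _ = 5 ^ k + 1 := by rw [ha, map_one, norm_one]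
    _ ≤ 2 * 5 ^ k := by linarith

/-- `|φ(λ_k) − 1/2| ≤ 1/4` for every embedding `φ : F → ℂ` (`λ_k − 1/2 = −1/(2b)`, `|b| ≥ 2`).
[cite: MochizukiGenEll2010, Ex 1.3 (ii) p.5] -/
theorem dist_embedding_lam_le [IsCyclotomicExtension {4} ℚ F] (hζ : IsPrimitiveRoot ζ 4) (φ : F →+* ℂ) {k : ℕ}
    (hk : 1 ≤ k) :
    dist (φ ((2 + (ζ : F)) ^ (2 * k) / (2 * (2 + (ζ : F)) ^ (2 * k) + 1))) 2⁻¹ ≤ 4⁻¹ := by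
  rw [dist_eq_norm]
  have h : φ ((2 + (ζ : F)) ^ (2 * k) / (2 * (2 + (ζ : F)) ^ (2 * k) + 1)) - 2⁻¹ =
      φ ((2 + (ζ : F)) ^ (2 * k) / (2 * (2 + (ζ : F)) ^ (2 * k) + 1) - 2⁻¹) := by rw [map_sub, map_inv₀, map_ofNat]
  rw [h, lam_sub_half hζ hk, map_neg, map_inv₀, map_mul φ (2 : F) (2 * (2 + (ζ : F)) ^ (2 * k) + 1), map_ofNat,
    norm_neg, norm_inv, norm_mul, Complex.norm_ofNat]
  have h2 := two_le_norm_embedding_b hζ φ hk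
  have hpos : (0 : ℝ) < 2 * ‖φ (2 * (2 + (ζ : F)) ^ (2 * k) + 1)‖ := by positivity
  rw [inv_le_comm₀ hpos (by norm_num), inv_inv]
  linarith

/-- **`P_k ∈ K_V` for `K_V = CBData.std ∅`** (archimedean disc `|z − 1/2| ≤ 1/4`, empty nonarchimedean support): the
compact-domain input of `Cor22.condP6_of_seven_le`. [cite: MochizukiGenEll2010, Ex 1.3 (ii) p.5] -/
theorem mem_std_empty [IsCyclotomicExtension {4} ℚ F] (hζ : IsPrimitiveRoot ζ 4) {k : ℕ} (hk : 1 ≤ k) :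
    (⟨F, (2 + (ζ : F)) ^ (2 * k) / (2 * (2 + (ζ : F)) ^ (2 * k) + 1)⟩ : NFPoint) ∈ (CBData.std ∅ (by simp)).toSet := by
  refine ⟨fun τ => ?_, fun p hp => absurd hp (Finset.notMem_empty p)⟩
  change τ ((2 + (ζ : F)) ^ (2 * k) / (2 * (2 + (ζ : F)) ^ (2 * k) + 1)) ∈ CBData.stdArc
  rw [CBData.stdArc, mem_closedBall]
  exact dist_embedding_lam_le hζ τ hk

end LopsidedWitness

end Summit.ABC.IUTFork

end
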